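/-
Copyright (c) 2026 the pub-hodgecm-mathlib formalisation cell (harness21).  Prover seat hodgecm-mathlib-K2Liu-p25 (g0), Track B «K2-LIT»,
#184♮ = hLiu418 = `stmt-HodgeConjecture-24832`; ROAD Φ of socket #41, open surface (u-1b) of the TOP's edition 3b (LEAD F0P6-plan (g14) BATCH #49 arrow of record;
desk K2E5-p17 (g8) bytes 2026-09-04T15:47:11Z): the KIND-1 LATTICE LETTERS `hmaj₁` ∕ `hgr₁`.  THEOREMS ONLY (no `def`, no `instance`, no notation, no named-fact hypothesis,
no `sorry`); hypothesis-first.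
-/
import Summits.HodgeConjecture.HodgeConjecture.Theorems.K2LiuSiegelEisensteinWhittakerMajorant   -- ★ p861512 (K2E4-p10): the family-agnostic bookkeeping §1∕§2
import HarnessLib

/-!
# Crux `HLiu418`, ROAD Φ of socket #41 — `K2LiuSiegelEisensteinRankOneMajorant`: THE KIND-1 LATTICE LETTERS `hmaj₁` ∕ `hgr₁` OF THE TOP FROM A WEIGHTED GROWTH ON THE
# RANK-ONE INDICES AND ONE SUMMABLE WEIGHT

Cell `hodgecm-mathlib`, crux item hLiu418 = `stmt-HodgeConjecture-24832` (helper lane `--supports … --as helper`, count-neutral); consumer = ★ p861373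
`K2LiuSiegelEisensteinContinuationTopKinds.siegelEisensteinContinuation_of_kinds_fixedCarrier` (KIND-1 binders `h1off`, `hmaj₁`, `hgr₁`).
THE MATHEMATICS ([MoeglinWaldspurger1995, II.1.7, IV.1.9]; [Tan1999, §4 Prop. 4.8]; [KudlaRallis1994, §2]).  The rank-one packages `Ec₁ S` of the TOP (★ p861061
`exists_rankOne_package_cleared` per `S`, zero off the rank-one indices `S ≠ 0, det S = 0` — binder `h1off`) satisfy, along the R1 road ((R1-α) unfolding, (R1-γ) inner line, ★ G7
height comparison), a WEIGHTED growth `‖Ec₁ S s h‖ ≤ C(z)·w(S)·‖h‖^A` uniformly in the rank-one index `S = b·u⊗ū` with a SUMMABLE lattice weight `w ≥ 0` (the decay in `b` of the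
archimedean inner Whittaker function) — the content letter **`h1g`**, BY VALUE here and asked ONLY on the rank-one indices.  From it the two lattice letters of the TOP are
bookkeeping, exactly as for KIND W (★ p861512, whose §1 is family-agnostic and is imported, not retyped):
* §1 (abstract) `weightedGrowth_of_support` — a weighted growth asked on a support set `T` extends to all indices for a family vanishing off `T`;
* §2 (instance `X := H(𝔸)`, `ι :=` the TOP's lattice) **`rankOne_majorant_of_weightedGrowth`** = `hmaj₁` and **`rankOne_summedGrowth_of_weightedGrowth`** = `hgr₁`, BYTES VERBATIM,
  from `h1off`, `(w, hw, hws)` and `h1g` on the rank-one indices (§1 + ★ `whittaker_majorant_of_weightedGrowth` ∕ ★ `whittaker_summedGrowth_of_weightedGrowth` at `EcW := Ec₁`).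
NOT HERE: `h1g` itself (R1 lineage: the arch inner-Whittaker decay in `b`; ★ p861147's comparison gives per-`S` polynomial growth only).
HONEST LABEL.  Count-neutral helper; `HC_CM` is proved only modulo the 7 printed citations (2 remaining named inputs: hLiu418 = `stmt-HodgeConjecture-24832`,
h413 = `stmt-HodgeConjecture-24833`) until rung 0 closes.
-/

set_option autoImplicit false
set_option linter.dupNamespace false -- the mandated namespace repeats `HodgeConjecture.HodgeConjecture`

noncomputable section

namespace Summit.HodgeConjecture.HodgeConjecture.Cruxes.HLiu418.K2LiuSiegelEisensteinRankOneMajorant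

open Set Filter Topology Metric
open scoped BigOperators
open Summit.HodgeConjecture.HodgeConjecture.Cruxes.HLiu418.K2LiuSiegelEisensteinWhittakerMajorant

/-! ## §1 Abstract: a weighted growth on the support extends to all indices -/

section Abstract

variable {X : Type*} {ι : Type*}

/-- **WEIGHTED GROWTH OFF THE SUPPORT IS FREE**: if `E i s x = 0` for `i ∉ T` and `‖E i s x‖ ≤ C·w i·H(x)^A` near every `z` for `i ∈ T` (`C, A ≥ 0`, `w ≥ 0`, `H > 0`), the same
bound holds for every index `i`. [cite: MoeglinWaldspurger1995, IV.1.9] -/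
theorem weightedGrowth_of_support (H : X → ℝ) (hpos : ∀ x, 0 < H x) (E : ι → ℂ → X → ℂ) (T : Set ι) (hoff : ∀ i, i ∉ T → ∀ s x, E i s x = 0)
    (w : ι → ℝ) (hw : ∀ i, 0 ≤ w i)
    (hEg : ∀ z : ℂ, 0 < z.re → ∃ C A r : ℝ, 0 ≤ C ∧ 0 ≤ A ∧ 0 < r ∧ ∀ i ∈ T, ∀ s : ℂ, dist s z < r → ∀ x, ‖E i s x‖ ≤ C * w i * H x ^ A) :
    ∀ z : ℂ, 0 < z.re → ∃ C A r : ℝ, 0 ≤ C ∧ 0 ≤ A ∧ 0 < r ∧ ∀ i (s : ℂ), dist s z < r → ∀ x, ‖E i s x‖ ≤ C * w i * H x ^ A := by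
  intro z hz
  obtain ⟨C, A, r, hC, hA, hr, hle⟩ := hEg z hz
  refine ⟨C, A, r, hC, hA, hr, fun i s hs x => ?_⟩
  by_cases hi : i ∈ T
  · exact hle i hi s hs x
  · rw [hoff i hi s x, norm_zero]
    exact mul_nonneg (mul_nonneg hC (hw i)) (Real.rpow_nonneg (hpos x).le A)

end Abstract

/-! ## §2 The instance at `X := H(𝔸)`: the TOP's KIND-1 letters `hmaj₁`, `hgr₁` -/

section Instance

open scoped Matrix
open NumberField IsDedekindDomain
open Literature.NumberTheory.Automorphic Literature.NumberTheory.GelbartRogawski1991 Literature.NumberTheory.GelbartRogawski1991.GRConstruction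
open Literature.NumberTheory.K2Lit.SiegelDoubled
open K2LiuSiegelUnipotentFourierDefs

variable (L : Type) [Field L] [NumberField L] [IsCMField L] {N M n : ℕ} (hn : 0 < n) (e : Fin N × Fin M ≃ Fin n)
  (dV : Fin N → L) (hdV : ∀ i, IsCMField.complexConj L (dV i) = dV i)
  (dW : Fin M → L) (hdW : ∀ i, IsCMField.complexConj L (dW i) = dW i)

include hn in
/-- **THE RANK-ONE WEIGHTED GROWTH ON ALL INDICES** from `h1off` (zero off the rank-one indices, ★ p861373's binder VERBATIM) and the weighted growth `h1g` asked only for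
`S ≠ 0`, `det S = 0`. [cite: MoeglinWaldspurger1995, IV.1.9] [cite: KudlaRallis1994, §2] -/
theorem rankOne_weightedGrowth_of_support
    (Ec₁ : skewMatrices ((IsCMField.complexConj L : L ≃ₐ[Fp L] L) : L →+* L) ((gramR L e dV hdV dW hdW).map (algebraMap (Fp L) L)) → ℂ → HA L e dV hdV dW hdW → ℂ)
    (h1off : ∀ S : skewMatrices ((IsCMField.complexConj L : L ≃ₐ[Fp L] L) : L →+* L) ((gramR L e dV hdV dW hdW).map (algebraMap (Fp L) L)),
      ¬ ((S : Matrix (Fin n) (Fin n) L) ≠ 0 ∧ (S : Matrix (Fin n) (Fin n) L).det = 0) → ∀ s h, Ec₁ S s h = 0)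
    (w : skewMatrices ((IsCMField.complexConj L : L ≃ₐ[Fp L] L) : L →+* L) ((gramR L e dV hdV dW hdW).map (algebraMap (Fp L) L)) → ℝ) (hw : ∀ S, 0 ≤ w S)
    (h1g : ∀ z : ℂ, 0 < z.re → ∃ C A r : ℝ, 0 ≤ C ∧ 0 ≤ A ∧ 0 < r ∧
      ∀ S : skewMatrices ((IsCMField.complexConj L : L ≃ₐ[Fp L] L) : L →+* L) ((gramR L e dV hdV dW hdW).map (algebraMap (Fp L) L)),
        (S : Matrix (Fin n) (Fin n) L) ≠ 0 → (S : Matrix (Fin n) (Fin n) L).det = 0 → ∀ s : ℂ, dist s z < r → ∀ h : HA L e dV hdV dW hdW,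
          ‖Ec₁ S s h‖ ≤ C * w S * adelicHeightGL (n + n) L (h : GL (Fin (n + n)) (AdeleRing (𝓞 L) L)) ^ A) :
    ∀ z : ℂ, 0 < z.re → ∃ C A r : ℝ, 0 ≤ C ∧ 0 ≤ A ∧ 0 < r ∧ ∀ S (s : ℂ), dist s z < r → ∀ h : HA L e dV hdV dW hdW,
      ‖Ec₁ S s h‖ ≤ C * w S * adelicHeightGL (n + n) L (h : GL (Fin (n + n)) (AdeleRing (𝓞 L) L)) ^ A := by
  haveI : NeZero (n + n) := ⟨by omega⟩
  refine weightedGrowth_of_support (fun h : HA L e dV hdV dW hdW => adelicHeightGL (n + n) L (h : GL (Fin (n + n)) (AdeleRing (𝓞 L) L)))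
    (fun h => adelicHeightGL_pos_holds (h : GL (Fin (n + n)) (AdeleRing (𝓞 L) L))) Ec₁
    {S | (S : Matrix (Fin n) (Fin n) L) ≠ 0 ∧ (S : Matrix (Fin n) (Fin n) L).det = 0} (fun S hS => h1off S hS) w hw fun z hz => ?_
  obtain ⟨C, A, r, hC, hA, hr, hle⟩ := h1g z hz
  exact ⟨C, A, r, hC, hA, hr, fun S hS s hs h => hle S hS.1 hS.2 s hs h⟩

include hn in
/-- **`hmaj₁` OF THE TOP (ed. 3∕3b) FROM THE RANK-ONE WEIGHTED GROWTH AND A SUMMABLE WEIGHT** (binder BYTES VERBATIM): near every `(z, h₀)` one summable majorant `m` with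
`‖Ec₁ S s h‖ ≤ m S` — §1 + ★ `whittaker_majorant_of_weightedGrowth` at `EcW := Ec₁`. [cite: MoeglinWaldspurger1995, IV.1.9] [cite: Tan1999, §4 Prop. 4.8] -/
theorem rankOne_majorant_of_weightedGrowth
    (Ec₁ : skewMatrices ((IsCMField.complexConj L : L ≃ₐ[Fp L] L) : L →+* L) ((gramR L e dV hdV dW hdW).map (algebraMap (Fp L) L)) → ℂ → HA L e dV hdV dW hdW → ℂ)
    (h1off : ∀ S : skewMatrices ((IsCMField.complexConj L : L ≃ₐ[Fp L] L) : L →+* L) ((gramR L e dV hdV dW hdW).map (algebraMap (Fp L) L)),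
      ¬ ((S : Matrix (Fin n) (Fin n) L) ≠ 0 ∧ (S : Matrix (Fin n) (Fin n) L).det = 0) → ∀ s h, Ec₁ S s h = 0)
    (w : skewMatrices ((IsCMField.complexConj L : L ≃ₐ[Fp L] L) : L →+* L) ((gramR L e dV hdV dW hdW).map (algebraMap (Fp L) L)) → ℝ) (hw : ∀ S, 0 ≤ w S) (hws : Summable w)
    (h1g : ∀ z : ℂ, 0 < z.re → ∃ C A r : ℝ, 0 ≤ C ∧ 0 ≤ A ∧ 0 < r ∧
      ∀ S : skewMatrices ((IsCMField.complexConj L : L ≃ₐ[Fp L] L) : L →+* L) ((gramR L e dV hdV dW hdW).map (algebraMap (Fp L) L)),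
        (S : Matrix (Fin n) (Fin n) L) ≠ 0 → (S : Matrix (Fin n) (Fin n) L).det = 0 → ∀ s : ℂ, dist s z < r → ∀ h : HA L e dV hdV dW hdW,
          ‖Ec₁ S s h‖ ≤ C * w S * adelicHeightGL (n + n) L (h : GL (Fin (n + n)) (AdeleRing (𝓞 L) L)) ^ A) :
    ∀ z : ℂ, 0 < z.re → ∀ h₀ : HA L e dV hdV dW hdW, ∃ r > (0 : ℝ), ∃ V ∈ 𝓝 h₀,
      ∃ m : skewMatrices ((IsCMField.complexConj L : L ≃ₐ[Fp L] L) : L →+* L) ((gramR L e dV hdV dW hdW).map (algebraMap (Fp L) L)) → ℝ, Summable m ∧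
        ∀ s : ℂ, dist s z < r → ∀ h ∈ V, ∀ S, ‖Ec₁ S s h‖ ≤ m S :=
  whittaker_majorant_of_weightedGrowth L hn e dV hdV dW hdW Ec₁ w hw hws
    (rankOne_weightedGrowth_of_support L hn e dV hdV dW hdW Ec₁ h1off w hw h1g)

include hn in
/-- **`hgr₁` OF THE TOP (ed. 3∕3b) FROM THE RANK-ONE WEIGHTED GROWTH AND A SUMMABLE WEIGHT** (binder BYTES VERBATIM): `Σ_S ‖Ec₁ S s h‖ ≤ C·‖h‖^A` near every `z`, with
summability — §1 + ★ `whittaker_summedGrowth_of_weightedGrowth` at `EcW := Ec₁`. [cite: MoeglinWaldspurger1995, II.1.7, IV.1.9] [cite: Tan1999, §4 Prop. 4.8] -/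
theorem rankOne_summedGrowth_of_weightedGrowth
    (Ec₁ : skewMatrices ((IsCMField.complexConj L : L ≃ₐ[Fp L] L) : L →+* L) ((gramR L e dV hdV dW hdW).map (algebraMap (Fp L) L)) → ℂ → HA L e dV hdV dW hdW → ℂ)
    (h1off : ∀ S : skewMatrices ((IsCMField.complexConj L : L ≃ₐ[Fp L] L) : L →+* L) ((gramR L e dV hdV dW hdW).map (algebraMap (Fp L) L)),
      ¬ ((S : Matrix (Fin n) (Fin n) L) ≠ 0 ∧ (S : Matrix (Fin n) (Fin n) L).det = 0) → ∀ s h, Ec₁ S s h = 0)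
    (w : skewMatrices ((IsCMField.complexConj L : L ≃ₐ[Fp L] L) : L →+* L) ((gramR L e dV hdV dW hdW).map (algebraMap (Fp L) L)) → ℝ) (hw : ∀ S, 0 ≤ w S) (hws : Summable w)
    (h1g : ∀ z : ℂ, 0 < z.re → ∃ C A r : ℝ, 0 ≤ C ∧ 0 ≤ A ∧ 0 < r ∧
      ∀ S : skewMatrices ((IsCMField.complexConj L : L ≃ₐ[Fp L] L) : L →+* L) ((gramR L e dV hdV dW hdW).map (algebraMap (Fp L) L)),
        (S : Matrix (Fin n) (Fin n) L) ≠ 0 → (S : Matrix (Fin n) (Fin n) L).det = 0 → ∀ s : ℂ, dist s z < r → ∀ h : HA L e dV hdV dW hdW,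
          ‖Ec₁ S s h‖ ≤ C * w S * adelicHeightGL (n + n) L (h : GL (Fin (n + n)) (AdeleRing (𝓞 L) L)) ^ A) :
    ∀ z : ℂ, 0 < z.re → ∃ C A r : ℝ, 0 < r ∧ ∀ s : ℂ, dist s z < r → ∀ h : HA L e dV hdV dW hdW,
      (Summable fun S => ‖Ec₁ S s h‖) ∧ ∑' S, ‖Ec₁ S s h‖ ≤ C * adelicHeightGL (n + n) L (h : GL (Fin (n + n)) (AdeleRing (𝓞 L) L)) ^ A :=
  whittaker_summedGrowth_of_weightedGrowth L e dV hdV dW hdW Ec₁ w hws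
    (rankOne_weightedGrowth_of_support L hn e dV hdV dW hdW Ec₁ h1off w hw h1g)

end Instance

end Summit.HodgeConjecture.HodgeConjecture.Cruxes.HLiu418.K2LiuSiegelEisensteinRankOneMajorant

end
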